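import Summits.SmoothPoincare4.SmoothPoincare4.Theses.WeakReductionDescent
import Summits.SmoothPoincare4.SmoothPoincare4.Theorems.DependentTripleAtThree.Negative.OfSmoothPoincare4

/-!
# Disproof of `DependentTripleAtThree` — findings: NO KILL POSSIBLE IN PRINCIPLE (SPC4-shielded, kernel-certified); every single-hypothesis mutation is either already refuted (trisection hyp), false only in kind (`e`, witness `#³ℂP²`, arithmetic core LANDED), or open (minimality = AZ25 Q8.3 / genus-3 Waldhausen); homology never obstructs the conclusion for a homotopy sphere (LANDED); line `Sketch`: apex stub shielded and strictly above the crux, GK L13 stub audited faithful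

Crux workfile of the standing disprover (cdisprove), crux item stmt-SmoothPoincare4-17999
`Summit.SmoothPoincare4.SmoothPoincare4.Theses.WeakReductionDescent.DependentTripleAtThree`
(route WeakReductionDescent rev 4, rank 4; piece X₁ of the rung split of K1).  Cycle 1, 2026-08-17,
seat refuter-cdisprove-stmt-SmoothPoincare4-17999-0.  LANDED from this cycle under
`Theorems/DependentTripleAtThree/Negative/`: `HomologicalShadow.lean` (p167074, ACCEPTED),
`StubGtriMorse1121.lean` (p169240), `MinimalityPrice.lean` (p169622).  It EXTENDS, and does not repeat, the birth
refuter's `Cruxes/DependentTripleAtThree/BirthAttack.lean` and the landed negative lane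
`Theorems/DependentTripleAtThree/Negative/OfSmoothPoincare4.lean` (p158116), which this file imports
and cites by name.  Prose only in docstrings / comments; `sorry` nowhere.

## Index of findings

* §1 SHIELD (cited, p158116).  `not_smoothPoincare4_of_not_dependentTripleAtThree`,
  `exotic_of_not_dependentTripleAtThree`, `not_minimal_three_of_diffeomorph`: the hypotheses
  `IsGKTrisection M 3 k T ∧ (∀ trisections, genus ≥ 3)` fail on every `M ≅ S⁴` (GK's genus-`0`
  trisection of `S⁴`, PROVED, transported by `IsGKTrisection.image_diffeomorph'`, PROVED), so a
  counterexample is an exotic 4-sphere of trisection genus exactly `3`.  NEW here (§1):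
  `not_minimal_three_of_small_trisection` — the rung is empty on ANY `M` carrying a GK-trisection of
  genus `≤ 2` (no diffeomorphism needed), and `dependentTripleAtThree_vacuous_iff` — the crux is
  LITERALLY the statement "minimal genus-3 trisected homotopy spheres have dependent triples", whose
  hypothesis class has no known inhabitant; there is nothing to search.
* §2 LOAD-BEARING HYPOTHESES, one at a time (the disprover's mutation table):
  - `IsGKTrisection M 3 k T` dropped ⇒ FALSE (`dependentTriple_false_without_trisection`, p158116:
    `S⁴`, empty sectors).
  - `e : M ≃ₕ S⁴` dropped ⇒ FALSE IN KIND, witness `#³ℂP²` with its minimal `(3;0,0,0)` trisection: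
    no dependent triple because its homological SHADOW is already impossible —
    `Negative/HomologicalShadow.lean` (p167074, this seat): `shadowTriple_false_threeCP2`.  Not a Lean
    refutation of the mutated statement (no `#³ℂP²` with a certified trisection in the tree).
  - minimality dropped ⇒ OPEN: `WithoutMinimality` (§4) contains "every genus-3 GK-trisection of `S⁴`
    admits a dependent triple", true if the genus-3 case of 4-dimensional Waldhausen holds, false iff
    some genus-3 trisection of a homotopy sphere has none — AZ25 Question 8.3 (p. 27 L23–31: candidates
    = lifts of the 4-bridge trisections of twist-spun 2-bridge knots, MZ17a Fig. 22, `≅ S⁴` for odd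
    twist).  "No dependent triple" is not finitely certifiable, so no compute job can settle it.
  - genus `3 ↦ 0` ⇒ FALSE at the round `S⁴` (minimal genus `0`, `F = S²`, every circle separates —
    Jordan; paper witness, no JCT in Mathlib); `3 ↦ 1, 2` ⇒ vacuous on `S⁴` like `3`.
  - `k` unrestricted: harmless (`Σ kᵢ = 3` proved; `(3;1,1,1)` modulo MSZ16 — BirthAttack (g)).
* §2′ HOMOLOGY NEVER OBSTRUCTS FOR A HOMOTOPY SPHERE (p167074): `shadowTriple_of_common_class` — as
  soon as one pairwise Lagrangian intersection `L_α ∩ L_β ⊂ H₁(Σ₃)` is nonzero (iff the sector it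
  bounds has `k ≥ 1`; always for `χ = 2`) the shadow `(a, a, c)` exists; `shadowTriple_sphere_threeOneOneOne`
  the instance for the standard `(3;1,1,1)` Lagrangians.  CONSEQUENCE FOR IDEATORS: no
  Lagrangian / intersection-form certificate can prove OR refute the crux's conclusion; every line
  must work with the disc sets (as AZ25 §§5–7 do).  The obstruction that kills the no-`e` mutation
  lives exactly in the `k = (0,0,0)` sector, which `χ = 2` excludes.
* §3 TARGETS — line `Sketch` (lead prover-line-stmt-SmoothPoincare4-17999-0; stubs `stub_factGKLemma13`,
  `stub_gtriMorse1121`; payload `stuck_stubs = []`):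
  - `stub_gtriMorse1121` (= item 0435 verbatim) is SPC4-SHIELDED: `not_smoothPoincare4_of_not_stubGtriMorse1121`,
    `exotic_of_not_stubGtriMorse1121` (this file; landing copy `Negative/StubGtriMorse1121.lean`).  No
    `stub_false` short of an exotic sphere.  STRENGTH: crux ≤ apex mod GK L13 (certificate p165900,
    contrapositive `not_gtriMorse1121_of_not_dependentTripleAtThree` in the landing copy); the converse
    is not available — a `(1,1,2,1,1)` handle decomposition gives `(g;1,g−2,1)` trisections with `g`
    unbounded, the crux is the `g = 3` slice — so the apex (= Property R for Mazur-type pieces, Gompf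
    1603.05090 Q2.2) is a priori STRICTLY STRONGER than the crux.  Information for planners, not a defect.
  - `stub_factGKLemma13` (= named fact `gkTrisection_exists_isMorse_isSelfIndexing`, GK16 Lemma 13):
    formal statement AUDITED against `Literature/Topology/FourManifolds/Morse.lean`: `IsMorse` = `C^∞`
    + nondegenerate `mhessian` at critical points; `IsSelfIndexing` = `f x = morseIndex x` at critical
    points (NO distinct-critical-values clause, so the multiplicities `(1, k 0, g - k 1, k 2, 1)` are
    admissible); `criticalSetOfIndex … |>.ncard` (junk `0` on infinite sets irrelevant for an ∃-claim);
    `g - k 1` truncated subtraction harmless (`k 1 ≤ g` for every genuine trisection: Heegaard genus of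
    `#^{k₁} S¹×S²`).  Verdict: a TRUE known theorem, tree debt (Waldhausen + Laudenbach–Poénaru);
    nothing to refute.
  - JOINT SUFFICIENCY: `DependentTripleAtThree_of` in the registered skeleton is kernel-checked and
    uses both stubs; nothing smuggled (the `k ≠ (1,1,1)` types are absorbed by the proved relabelling,
    not assumed away).
* §4 STRENGTHENINGS (defs + status): `WithoutMinimality` (open, ⊇ genus-3 SPC4 ∧ "every genus-3
  trisection of `S⁴` has a dependent triple": `genusThree_standard_of_withoutMinimality`);
  `WithoutHomotopyEquiv` (false in kind, §2); monotonicity `dependentTripleAtThree_of_withoutMinimality`;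
  and the EXACT PRICE OF MINIMALITY: `withoutMinimality_iff` — modulo `LowGenusBase`,
  `WithoutMinimality ↔ DependentTripleAtThree ∧ W3` with `W3` := every genus-3 GK-trisection of an
  `M ≅ S⁴` has a dependent triple (genus-3 shadow of 4D Waldhausen, about the standard sphere only):
  minimality is load-bearing iff `W3` fails.
* §5 NOT RUN / NEAR-MISSES (comments at the end): the lead's `disprover-wanted` dependent-triple
  search on explicit non-standard-looking `(3;1,1,1)` diagrams of `S⁴` — not run this cycle: the
  candidate diagrams (MZ17a Fig. 22 lifts) are figures, not data, in the held text; a bounded search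
  can only FIND triples (removing a Q8.3 candidate), never certify absence; and either outcome leaves
  this item where it is (S⁴'s genus-3 trisections are never minimal).  Recorded with the exact
  harness a future seat would need.

WHY IT RESISTS (one paragraph for the provers).  The statement is a conjunction-free ∀ over a
hypothesis class — smooth homotopy 4-spheres of trisection genus EXACTLY 3 — that is empty under
SPC4 and has no known member; modulo the sibling support X_F (AZ25 Thm 1.4) it is EQUIVALENT to the
emptiness of that class (`dependentTripleAtThree_iff_noMinimalGenusThree`), i.e. to the `(3;1,1,1)`
case of SPC4.  A disproof is an exotic `S⁴`; a proof is genus-3 SPC4.  The dependent-triple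
language is a certificate format that homology cannot see (§2′) and that print controls only from
the INSIDE (given a triple, AZ25 classify), never from minimality.
-/

noncomputable section

set_option linter.dupNamespace false

open scoped Manifold ContDiff Topology ContinuousMap
open Set Function Literature.Topology.FourManifolds
open Summit.SmoothPoincare4.SmoothPoincare4.Theses.WeakReductionDescent
open Summit.SmoothPoincare4.SmoothPoincare4.Theorems.DependentTripleAtThree.Negative

namespace Summit.SmoothPoincare4.SmoothPoincare4.Cruxes.DependentTripleAtThree.Disproof

/-- The round `4`-sphere of Mathlib. -/
local notation "𝕊⁴" => (Metric.sphere (0 : EuclideanSpace ℝ (Fin 5)) 1)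

/-! ## §1 Shield (cited) and two small additions -/

section Shield

variable {M : Type} [TopologicalSpace M] [ChartedSpace (EuclideanSpace ℝ (Fin 4)) M]

/-- Cited from the landed negative lane (p158116): a kill of the crux kills the summit. -/
example (h : ¬ DependentTripleAtThree) : ¬ _root_.SmoothPoincare4 :=
  not_smoothPoincare4_of_not_dependentTripleAtThree h

omit [ChartedSpace (EuclideanSpace ℝ (Fin 4)) M] in
/-- **NEW (tightness of the shield): no diffeomorphism is needed to empty the rung** — if `M`
carries ANY GK-trisection of genus `≤ 2` then the crux's minimality hypothesis at genus `3` fails.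
So the hypothesis class of the crux is "homotopy 4-spheres of trisection genus EXACTLY 3"; by
`LowGenusBase` (MSZ16/MZ17, route support) these are exotic. [folklore] -/
theorem not_minimal_three_of_small_trisection [ChartedSpace (EuclideanSpace ℝ (Fin 4)) M]
    {g₀ : ℕ} (hg₀ : g₀ ≤ 2) {k₀ : Fin 3 → ℕ} {T₀ : Fin 3 → Set M}
    (hT₀ : IsGKTrisection M g₀ k₀ T₀)
    (hmin : ∀ (g' : ℕ) (k' : Fin 3 → ℕ) (T' : Fin 3 → Set M), IsGKTrisection M g' k' T' → 3 ≤ g') :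
    False := by
  have := hmin g₀ k₀ T₀ hT₀
  omega

end Shield

/-- The crux's hypothesis class, as a predicate: "`T` is a genus-3 GK-trisection of the smooth
homotopy 4-sphere `(M, e)` and `M` has no trisection of smaller genus". [folklore] -/
def InRung (M : Type) [TopologicalSpace M] [ChartedSpace (EuclideanSpace ℝ (Fin 4)) M]
    (k : Fin 3 → ℕ) (T : Fin 3 → Set M) : Prop :=
  IsGKTrisection M 3 k T ∧
    ∀ (g' : ℕ) (k' : Fin 3 → ℕ) (T' : Fin 3 → Set M), IsGKTrisection M g' k' T' → 3 ≤ g'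

/-- **The rung is empty on every standard sphere** (restating `not_minimal_three_of_diffeomorph`,
p158116, over `InRung`): there is no instance of the crux's hypotheses on any `M ≅ S⁴`; the only
possible instances live on exotic 4-spheres, none of which is known.  Nothing to enumerate, no
small model, no `kit compute` target. [folklore] -/
theorem not_inRung_of_diffeomorph {M : Type} [TopologicalSpace M]
    [ChartedSpace (EuclideanSpace ℝ (Fin 4)) M] [IsManifold (𝓡 4) ∞ M]
    (Φ : M ≃ₘ⟮𝓡 4, 𝓡 4⟯ 𝕊⁴) (k : Fin 3 → ℕ) (T : Fin 3 → Set M) : ¬ InRung M k T :=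
  fun h => not_minimal_three_of_diffeomorph Φ h.2

/-! ## §2 Load-bearing hypotheses — the mutation table as statements

The three single-hypothesis mutations of the crux.  Status in the docstrings; the Lean content that
exists is cited (p158116) or landed separately (p167074, pure arithmetic over `Fin 6 → ℤ`, not
imported here to keep this workfile buildable before that proposal applies). -/

/-- The `let`-bound conclusion of the crux, verbatim, as a predicate of `M` and the sectors `T`
(= `BirthAttack.DT`; repeated because crux workfiles cannot import each other). [folklore] -/
def DT (M : Type) [TopologicalSpace M] [ChartedSpace (EuclideanSpace ℝ (Fin 4)) M]
    (T : Fin 3 → Set M) : Prop :=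
  (let F : Set M := ⋂ l, T l; let H : Fin 3 → Set M := fun p => ⋂ (l : Fin 3) (_ : l ≠ p), T l; let IsCurve : Set M → Prop := fun c => c ⊆ F ∧ ∃ γ : (Metric.sphere (0 : EuclideanSpace ℝ (Fin 2)) 1) → M, Manifold.IsSmoothEmbedding (𝓡 1) (𝓡 4) ((⊤ : ℕ∞) : WithTop ℕ∞) γ ∧ Set.range γ = c; let BoundsDisc : Set M → Set M → Prop := fun A c => ∃ d : (Metric.closedBall (0 : EuclideanSpace ℝ (Fin 2)) 1) → M, Manifold.IsSmoothEmbedding (𝓡∂ 2) (𝓡 4) ((⊤ : ℕ∞) : WithTop ℕ∞) d ∧ Set.range d ⊆ A ∧ d '' ((𝓡∂ 2).boundary (Metric.closedBall (0 : EuclideanSpace ℝ (Fin 2)) 1)) = c ∧ Set.range d ∩ F = c; let NonSep : Set M → Prop := fun c => IsConnected (F \ c); let DependentTriple : Prop := ∃ (a b c : Set M), IsCurve a ∧ IsCurve b ∧ IsCurve c ∧ Disjoint a b ∧ Disjoint b c ∧ Disjoint a c ∧ NonSep a ∧ NonSep b ∧ NonSep c ∧ BoundsDisc (H 0) a ∧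 BoundsDisc (H 1) b ∧ BoundsDisc (H 2) c ∧ ¬ IsPreconnected (F \ (a ∪ b ∪ c)); DependentTriple)

/-- The crux read back through `InRung` / `DT` (`Iff.rfl`: these ARE its clauses). [folklore] -/
theorem dependentTripleAtThree_iff_inRung :
    DependentTripleAtThree ↔
      ∀ (M : Type) [TopologicalSpace M] [T2Space M] [SecondCountableTopology M]
        [ChartedSpace (EuclideanSpace ℝ (Fin 4)) M] [IsManifold (𝓡 4) ∞ M],
        (M ≃ₕ 𝕊⁴) → ∀ (k : Fin 3 → ℕ) (T : Fin 3 → Set M), InRung M k T → DT M T := by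
  constructor
  · intro h M _ _ _ _ _ e k T hR
    exact h M e k T hR.1 hR.2
  · intro h M _ _ _ _ _ e k T hT hmin
    exact h M e k T ⟨hT, hmin⟩

/-- **Mutation 1 — drop the trisection hypothesis: FALSE** (cited, p158116: `S⁴` with empty
sectors; the central surface is empty but a curve is the image of the nonempty circle). -/
example :
    ¬ ∀ (M : Type) [TopologicalSpace M] [T2Space M] [SecondCountableTopology M]
        [ChartedSpace (EuclideanSpace ℝ (Fin 4)) M] [IsManifold (𝓡 4) ∞ M],
        (M ≃ₕ 𝕊⁴) → ∀ (_k : Fin 3 → ℕ) (T : Fin 3 → Set M), DT M T :=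
  dependentTriple_false_without_trisection

/-- **Mutation 2 — drop `e : M ≃ₕ S⁴`** (everything else verbatim, `M` any Hausdorff second
countable smooth 4-manifold).  STATUS: FALSE IN KIND, not refutable in Lean today.  Witness
`#³ℂP²` with the connected sum `T` of three genus-`1` trisections of `ℂP²` (type `(3;0,0,0)`):
minimal (Chu–Tillmann `g ≥ χ − 2 + 3 rk π₁ = 5 − 2 = 3`), and WITHOUT dependent triple because even
the homological shadow of one is impossible — `Negative/HomologicalShadow.lean`
`shadowTriple_false_threeCP2` (p167074): for `a ∈ L_α = ⟨e₀,e₂,e₄⟩`, `b ∈ L_β = ⟨e₁,e₃,e₅⟩`,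
`c ∈ L_γ = ⟨e₀+e₁,e₂+e₃,e₄+e₅⟩` nonzero and pairwise orthogonal, `l a + m b + n c = 0` forces
`l Σ a₂ᵢ² = 0` and every branch ends in a zero vector.  (Consistent with AZ25 Thm 1.4: `#³ℂP²` is on
the list a dependent triple ALLOWS; the theorem does not say its trisections have one.)  The Lean
refutation of THIS def needs `#³ℂP²` as a `ChartedSpace` with a certified `IsGKTrisection … 3 0 T`
and the curve ↦ `H₁` dictionary — none in the tree. [folklore] -/
def WithoutHomotopyEquiv : Prop :=
  ∀ (M : Type) [TopologicalSpace M] [T2Space M] [SecondCountableTopology M]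
    [ChartedSpace (EuclideanSpace ℝ (Fin 4)) M] [IsManifold (𝓡 4) ∞ M],
    ∀ (k : Fin 3 → ℕ) (T : Fin 3 → Set M), InRung M k T → DT M T

/-- The mutation is (trivially) at least as strong as the crux. [folklore] -/
theorem dependentTripleAtThree_of_withoutHomotopyEquiv (h : WithoutHomotopyEquiv) :
    DependentTripleAtThree := by
  rw [dependentTripleAtThree_iff_inRung]
  intro M _ _ _ _ _ _e k T hR
  exact h M k T hR

/-- **Mutation 3 — drop minimality** (keep `e` and the genus-3 trisection).  STATUS: OPEN.  On
`M = S⁴` it says every genus-3 GK-trisection of `S⁴` admits a dependent triple — implied by the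
genus-3 case of the 4-dimensional Waldhausen conjecture (every trisection of `S⁴` is a stabilisation
of the genus-0 one; the standard `(3;1,1,1)` / unbalanced genus-3 diagrams are reducible, hence
carry dependent triples), and FALSE iff some genus-3 trisection of a homotopy 4-sphere has no
dependent triple, which contains Aranda–Zupan's open Question 8.3 (arXiv:2503.04607 p. 27 L23–31:
"Do there exist genus-three trisections that are not weakly reducible? … potentially strongly
irreducible (3;1)-trisections can be obtained by lifting the 4-bridge trisection of the m-twist
spun knot S_m(K), K a 2-bridge knot … When m is odd, X ≅ S⁴").  A strongly irreducible trisection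
may still carry a case-(3) dependent triple (pants-cobounding), so even a positive answer to Q8.3
would not settle this def.  Not finitely certifiable either way. [folklore] -/
def WithoutMinimality : Prop :=
  ∀ (M : Type) [TopologicalSpace M] [T2Space M] [SecondCountableTopology M]
    [ChartedSpace (EuclideanSpace ℝ (Fin 4)) M] [IsManifold (𝓡 4) ∞ M],
    (M ≃ₕ 𝕊⁴) → ∀ (k : Fin 3 → ℕ) (T : Fin 3 → Set M), IsGKTrisection M 3 k T → DT M T

/-- Monotonicity: the no-minimality strengthening implies the crux. [folklore] -/
theorem dependentTripleAtThree_of_withoutMinimality (h : WithoutMinimality) :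
    DependentTripleAtThree := by
  rw [dependentTripleAtThree_iff_inRung]
  intro M _ _ _ _ _ e k T hR
  exact h M e k T hR.1

/-- **What the no-minimality strengthening buys, modulo X_F**: together with the route's support
`DependentTripleGenusThreeStandard` (AZ25 Thm 1.4 / Cor 1.5 for homotopy spheres) it gives the FULL
genus-3 case of SPC4 — every smooth homotopy 4-sphere with a genus-3 GK-trisection (minimal or not)
is `≅ S⁴` — whereas the crux + X_F only empties the MINIMAL genus-3 rung
(`dependentTripleAtThree_iff_noMinimalGenusThree`).  Modulo `LowGenusBase` the two coincide (a
non-minimal genus-3 trisection sits on an `M` of genus `≤ 2`, standard by MSZ16/MZ17), so dropping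
minimality costs nothing in truth value modulo print — but it removes the only hypothesis no known
`S⁴`-diagram technique can use, which is why the planner kept it. [folklore] -/
theorem genusThree_standard_of_withoutMinimality (h : WithoutMinimality)
    (hF : DependentTripleGenusThreeStandard)
    {M : Type} [TopologicalSpace M] [T2Space M] [SecondCountableTopology M]
    [ChartedSpace (EuclideanSpace ℝ (Fin 4)) M] [IsManifold (𝓡 4) ∞ M]
    (e : M ≃ₕ 𝕊⁴) {k : Fin 3 → ℕ} {T : Fin 3 → Set M} (hT : IsGKTrisection M 3 k T) :
    Nonempty (M ≃ₘ⟮𝓡 4, 𝓡 4⟯ 𝕊⁴) :=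
  hF M e k T hT (h M e k T hT)

/-- **`W3` — what minimality buys, exactly.**  Every genus-3 GK-trisection of a smooth
4-manifold DIFFEOMORPHIC to `S⁴` admits a dependent triple: the genus-3 dependent-triple shadow of
the 4-dimensional Waldhausen conjecture ("every trisection of `S⁴` is a stabilisation of the
genus-0 one", AZ25 p. 27), a statement about the standard sphere alone (by
`IsGKTrisection.image_diffeomorph'` it is equivalent to its instance `M = S⁴`, transport of `DT`
along `Φ` being routine but unformalised).  OPEN; ⊇ "the AZ25 Q8.3 candidates that are `≅ S⁴` carry
dependent triples".  This — and nothing else — is what the crux's minimality hypothesis saves the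
prover from (`withoutMinimality_iff`). [folklore] -/
def W3 : Prop :=
  ∀ (M : Type) [TopologicalSpace M] [T2Space M] [SecondCountableTopology M]
    [ChartedSpace (EuclideanSpace ℝ (Fin 4)) M] [IsManifold (𝓡 4) ∞ M],
    Nonempty (M ≃ₘ⟮𝓡 4, 𝓡 4⟯ 𝕊⁴) → ∀ (k : Fin 3 → ℕ) (T : Fin 3 → Set M),
      IsGKTrisection M 3 k T → DT M T

/-- The no-minimality strengthening contains `W3` (a diffeomorphism is a homotopy equivalence).
[folklore] -/
theorem w3_of_withoutMinimality (h : WithoutMinimality) : W3 := by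
  intro M _ _ _ _ _ hΦ k T hT
  obtain ⟨Φ⟩ := hΦ
  exact h M Φ.toHomeomorph.toHomotopyEquiv k T hT

/-- Conversely, crux + `W3` give the strengthening, modulo the route's support `LowGenusBase`
(MSZ16 / MZ17: genus `≤ 2` homotopy spheres are standard): a non-minimal genus-3 trisection sits on
an `M` with a trisection of genus `≤ 2`, hence `M ≅ S⁴`, and `W3` applies; a minimal one is the
crux's. [folklore] -/
theorem withoutMinimality_of_dependentTripleAtThree_of_w3 (hL : LowGenusBase)
    (h1 : DependentTripleAtThree) (h3 : W3) : WithoutMinimality := by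
  intro M _ _ _ _ _ e k T hT
  by_cases hmin : ∀ (g' : ℕ) (k' : Fin 3 → ℕ) (T' : Fin 3 → Set M), IsGKTrisection M g' k' T' → 3 ≤ g'
  · exact (dependentTripleAtThree_iff_inRung.1 h1) M e k T ⟨hT, hmin⟩
  · push Not at hmin
    obtain ⟨g', k', T', hT', hlt⟩ := hmin
    exact h3 M (hL M e g' k' T' hT' (by omega)) k T hT

/-- **MINIMALITY IS LOAD-BEARING IFF `W3` FAILS** (modulo `LowGenusBase`):
`WithoutMinimality ↔ DependentTripleAtThree ∧ W3`.  So the mutation "drop minimality" is refutable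
exactly when the STANDARD `S⁴` carries a genus-3 GK-trisection with no dependent triple — a
sub-question of AZ25 Q8.3 about `S⁴` itself, untouched by any exotic phenomenon, and the precise
target of the lead's `disprover-wanted` computation (which can only ever confirm instances of `W3`,
never refute it by bounded search). [folklore] -/
theorem withoutMinimality_iff (hL : LowGenusBase) :
    WithoutMinimality ↔ DependentTripleAtThree ∧ W3 :=
  ⟨fun h => ⟨dependentTripleAtThree_of_withoutMinimality h, w3_of_withoutMinimality h⟩,
    fun h => withoutMinimality_of_dependentTripleAtThree_of_w3 hL h.1 h.2⟩

/-- **Mutation 4 — the genus parameter.**  Replacing `3` by `g₀`: for `g₀ = 1, 2` the rung is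
empty on `S⁴` exactly as for `3` (genus `0` exists), so those variants are equally shielded; for
`g₀ = 0` the variant is FALSE at the round `S⁴` — its genus-`0` trisection
(`sphere_genusZero_gkTrisection_holds`) IS minimal, and its central surface is a 2-sphere on which
every embedded circle separates (Jordan–Schoenflies), so `NonSep a` fails for every curve.  Paper
witness only: Mathlib has no Jordan curve theorem.  Here the shielded half, checked. [folklore] -/
theorem rung_empty_on_sphere_of_pos {g₀ : ℕ} (hg₀ : 1 ≤ g₀) (k : Fin 3 → ℕ)
    (T : Fin 3 → Set 𝕊⁴) (_hT : IsGKTrisection 𝕊⁴ g₀ k T)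
    (hmin : ∀ (g' : ℕ) (k' : Fin 3 → ℕ) (T' : Fin 3 → Set 𝕊⁴), IsGKTrisection 𝕊⁴ g' k' T' → g₀ ≤ g') :
    False := by
  obtain ⟨T₀, hT₀⟩ := exists_isGKTrisection_genus_zero_of_diffeomorph (Diffeomorph.refl (𝓡 4) 𝕊⁴ ∞)
  have := hmin 0 (fun _ => 0) T₀ hT₀
  omega

/-! ## §3 Targets — line `Sketch` (stubs `stub_factGKLemma13`, `stub_gtriMorse1121`)

Landing copy: `Theorems/DependentTripleAtThree/Negative/StubGtriMorse1121.lean` (this seat). -/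

/-- The registered apex stub `stub_gtriMorse1121`, verbatim (= item stmt-SmoothPoincare4-0435
`GroupTrisection.GtriMorse1121`, `Iff.rfl` by `ContractibleTwistedDoubleStandard.Negative.gtriMorse1121_iff`). -/
def StubGtriMorse1121 : Prop :=
  ∀ (M : Type) [TopologicalSpace M] [T2Space M] [SecondCountableTopology M] [ChartedSpace (EuclideanSpace ℝ (Fin 4)) M] [IsManifold (𝓡 4) ((⊤ : ℕ∞) : WithTop ℕ∞) M] [CompactSpace M], M ≃ₕ Metric.sphere (0 : EuclideanSpace ℝ (Fin 5)) 1 → ∀ f : M → ℝ, Literature.Topology.FourManifolds.IsMorse (𝓡 4) f → (Literature.Topology.FourManifolds.criticalSetOfIndex (𝓡 4) f 0).ncard = 1 → (Literature.Topology.FourManifolds.criticalSetOfIndex (𝓡 4) f 1).ncard ≤ 1 → (Literature.Topology.FourManifolds.criticalSetOfIndex (𝓡 4) f 3).ncard ≤ 1 → (Literature.Topology.FourManifolds.criticalSetOfIndex (𝓡 4) f 4).ncard = 1 → Nonempty (Diffeomorph (𝓡 4) (𝓡 4) M (Metric.sphere (0 : EuclideanSpace ℝ (Fin 5)) 1) ((⊤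 : ℕ∞) : WithTop ℕ∞))

/-- **The apex stub is SPC4-implied** (so it cannot be `stub_false` short of `¬ SPC4`): the summit
hands over `M ≅ S⁴` for every smooth homotopy 4-sphere; the Morse function is not even used.
[folklore] -/
theorem stubGtriMorse1121_of_smoothPoincare4 (hS : _root_.SmoothPoincare4) : StubGtriMorse1121 := by
  intro M _ _ _ _ _ _ e _f _ _ _ _ _
  exact hS M ‹_› ‹_› e

/-- A kill of the apex stub kills the summit. [folklore] -/
theorem not_smoothPoincare4_of_not_stubGtriMorse1121 (h : ¬ StubGtriMorse1121) :
    ¬ _root_.SmoothPoincare4 :=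
  fun hS => h (stubGtriMorse1121_of_smoothPoincare4 hS)

/-- **What a kill of the apex would be**: a closed smooth homotopy 4-sphere with a Morse function
of profile `(1, ≤1, ·, ≤1, 1)` and no diffeomorphism to `S⁴`. [folklore] -/
theorem exotic_of_not_stubGtriMorse1121 (h : ¬ StubGtriMorse1121) :
    ∃ (M : Type) (_ : TopologicalSpace M) (_ : T2Space M) (_ : SecondCountableTopology M)
      (_ : ChartedSpace (EuclideanSpace ℝ (Fin 4)) M) (_ : IsManifold (𝓡 4) ∞ M) (_ : CompactSpace M),
      Nonempty (M ≃ₕ 𝕊⁴) ∧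
      (∃ f : M → ℝ, IsMorse (𝓡 4) f ∧ (criticalSetOfIndex (𝓡 4) f 0).ncard = 1 ∧
        (criticalSetOfIndex (𝓡 4) f 1).ncard ≤ 1 ∧ (criticalSetOfIndex (𝓡 4) f 3).ncard ≤ 1 ∧
        (criticalSetOfIndex (𝓡 4) f 4).ncard = 1) ∧
      IsEmpty (M ≃ₘ⟮𝓡 4, 𝓡 4⟯ 𝕊⁴) := by
  refine Classical.byContradiction fun hcon => h ?_
  intro M _ _ _ _ _ _ e f hf c0 c1 c3 c4
  refine Classical.byContradiction fun hno => ?_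
  exact hcon ⟨M, inferInstance, inferInstance, inferInstance, inferInstance, inferInstance,
    inferInstance, ⟨e⟩, ⟨f, hf, c0, c1, c3, c4⟩, ⟨fun Φ => hno ⟨Φ⟩⟩⟩

/-! ### `stub_factGKLemma13` — audit record (no Lean content possible: it is a named `Prop` fact)

`Literature.Topology.FourManifolds.gkTrisection_exists_isMorse_isSelfIndexing` (TrisectionHandleDecomposition.lean:72):
for a compact connected oriented smooth `X` and `IsGKTrisection X g k S`, `∃ f, IsMorse f ∧ IsSelfIndexing f ∧`
critical counts `(1, k 0, g - k 1, k 2, 1)` in indices `0..4`.  Read against `Morse.lean`: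
`IsMorse I f := ContMDiff I 𝓘(ℝ,ℝ) ∞ f ∧ ∀ x, IsMCriticalPt I f x → (mhessian I f x).Nondegenerate`;
`IsSelfIndexing I f := ∀ x, IsMCriticalPt I f x → f x = morseIndex I f x`;
`criticalSetOfIndex I f k := {x | IsMCriticalPt I f x ∧ morseIndex I f x = k}`.
Smells checked: (i) no requirement that critical VALUES be distinct — several critical points of
one index share the value `index`, as self-indexing demands — OK; (ii) `ncard` junk `0` on infinite
sets — the fact is an ∃-claim and Morse critical sets on compact `X` are finite anyway — OK;
(iii) `g - k 1 : ℕ` — `k 1 ≤ g` holds for every genuine GK-trisection (the genus-`g` surface is a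
Heegaard surface of `#^{k 1} S¹×S²`, whose Heegaard genus is `k 1`) — OK; (iv) the Morse function is
NOT required to have the given sectors as sublevel sets (which would be false: `∂T i` has corners
along `F`) — only existence with the right counts — OK; (v) the orientation hypothesis is unused in
the conclusion — harmless.  Verdict: TRUE (Gay–Kirby 2016 Lemma 13 / MSZ16 §4), tree debt behind
`waldhausen_heegaardSplitting_sumS1S2_unique` + Laudenbach–Poénaru; not a target. -/

/-! ## §5 Not run this cycle / near-misses (no `sorry` kept)

* DISPROVER-WANTED (lead HANDOFF): "does an explicit non-standard-looking (3;1,1,1) diagram of `S⁴`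
  (AZ25 Q8.3 candidates; Hayano's simplified (3;1) diagram) admit a dependent triple? (curve ↦ word in
  `F₃`, trivial ⇔ compresses)".  NOT RUN.  Reasons, in order: (1) the inputs are FIGURES (MZ17a
  arXiv:1507.08370 Fig. 22 tri-plane diagrams; their lifts to `Σ₃`) that the held text extraction does
  not carry as data — transcription by hand from an unseen figure is not reliable; (2) a bounded
  enumeration of simple closed curves on `Σ₃` (Dehn–Thurston / normal coordinates + free reduction of
  the `α/β/γ`-words) can only FIND dependent triples — which removes a candidate from Q8.3's list but
  says nothing about this item — and can never certify ABSENCE, the only outcome that would make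
  minimality visibly load-bearing; (3) either way the item does not move (`S⁴`'s genus-3 trisections
  are never minimal, §1).  Harness a future compute seat would need: diagrams as three cut systems in
  Dehn–Thurston coordinates on a fixed pants decomposition of `Σ₃`; curve enumeration by DT length;
  disjointness by geometric intersection number (flipper/curver); `NonSep`/dependence by `ℤ/2`-homology
  rank; compressibility in `H_α` by the signed `α`-crossing word freely reduced in `F₃` (Dehn's lemma).
  One batched `kit compute` job; certificate = the three curves in coordinates.
* `_false_without_e` AS A LEAN THEOREM: blocked on a certified `(3;0,0,0)` trisection of `#³ℂP²` in
  the tree and the curve ↦ `H₁(Σ₃)` dictionary (none exist); arithmetic core landed instead (p167074).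
* `AtGenusZero` false on `S⁴` AS A LEAN THEOREM: blocked on the Jordan curve theorem for smooth
  circles in `S² ⊂ S⁴` (not in Mathlib).
-/

end Summit.SmoothPoincare4.SmoothPoincare4.Cruxes.DependentTripleAtThree.Disproof

end
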